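import Mathlib
import HarnessLib
import Summits.QuantumFields.YangMills.Theorems.MirrorModularBoostsHypercubicLimitPlaneLimitsDefs
import Summits.QuantumFields.YangMills.Theorems.MirrorModularBoostsHypercubicLimitPlanesTransfer
import Summits.QuantumFields.YangMills.Theorems.MirrorModularBoostsHypercubicLimitSubschemeDefs
import Summits.QuantumFields.YangMills.Theorems.MirrorModularBoostsHypercubicLimitPlaneDistTensor
import Literature.MathematicalPhysics.QuantumFieldTheory.LatticeGaugeProofs

/-!
# Line `Sketch` (coupling response), closure step Z3a: the convergence clause along the sub-scheme

Crux `stmt-QuantumFields-16154` (`HypercubicLimit`), line `Sketch`, reshape 4.  Along a `PlaneLimits r sch φ T` package the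
crux's convergence clause holds for the sub-scheme `subseq sch φ hφ` and the candidate family `planeSum T`: the lattice `n`-point
function of the curvature at step `φ k` is `∫ ∏ᵢ Φ_{φ k}(fᵢ)`, each `Φ = Σ_q Φ^q` (`sum_planeField_eq_curvField`), the product of sums is
the sum over plane strings of products (`Finset.prod_univ_sum`), each summand is the renormalised plane-string distribution on the
tensor (`planeDist_eq_integral_prod_planeField`), and the summed distributions converge to `planeSum T` on `⁰𝒮`
(`PlaneLimits.tendsto_planeSum`).
-/

noncomputable section

open scoped SchwartzMap
open MeasureTheory Filter Topology
open Literature.MathematicalPhysics.AQFT Literature.MathematicalPhysics.QuantumLattice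
open Literature.MathematicalPhysics.QuantumFieldTheory

namespace Summit.QuantumFields.YangMills.Cruxes.HypercubicLimit.CouplingResponse

section Facts

variable {G : Type} [Group G] [TopologicalSpace G] [IsTopologicalGroup G] [CompactSpace G]
  [MeasurableSpace G] [BorelSpace G]

/-- **The curvature's lattice `n`-point function is the sum over plane strings of the renormalised plane-string distributions**
on the real tensor. [folklore] -/
theorem latticeSchwinger_eq_sum_planeDist (r : LatticeRep G) (sch : SpeciesScheme (YMSpecies G)) (k n : ℕ)
    (f : Fin n → 𝓢(EuclideanSpace ℝ (Fin 4), ℝ)) (F : 𝓢((Fin n → EuclideanSpace ℝ (Fin 4)), ℂ))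
    (hF : IsTensorOf F (fun i => ofRealTest (f i))) :
    ((latticeSchwinger r.ρ sch (fun s => s.F) k n (fun _ => r.curvature) f : ℝ) : ℂ) =
      ∑ q : Fin n → Plane, planeDist r sch k n q F := by
  haveI : IsProbabilityMeasure (wilsonAt r sch k) :=
    isProbabilityMeasure_wilsonMeasure (d := 4) (L := sch.side k) r.ρ r.continuous (sch.β k)
  -- the integrand: product of curvature fields = sum over strings of products of plane fields
  have hprod : ∀ U : GaugeConfig 4 (sch.side k) G,
      ∏ i, curvField r sch k (f i) U = ∑ q : Fin n → Plane, ∏ i, planeField r sch k (q i) (f i) U := by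
    intro U
    simp_rw [← sum_planeField_eq_curvField]
    rw [Finset.prod_univ_sum]
    simp only [Fintype.piFinset_univ]
  have hint : ∀ q : Fin n → Plane, Integrable (fun U => ∏ i, planeField r sch k (q i) (f i) U) (wilsonAt r sch k) :=
    fun q => (IsBddMeas.prod Finset.univ fun i _ =>
      ⟨measurable_planeField r sch k (q i) (f i), exists_bound_planeField r sch k (q i) (f i)⟩).integrable _
  have hLS : latticeSchwinger r.ρ sch (fun s => s.F) k n (fun _ => r.curvature) f =
      ∫ U, ∏ i, curvField r sch k (f i) U ∂(wilsonAt r sch k) := rfl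
  rw [hLS]
  simp_rw [hprod]
  rw [integral_finsetSum _ fun q _ => hint q]
  push_cast
  exact Finset.sum_congr rfl fun q _ => (planeDist_eq_integral_prod_planeField G r sch k n q f F hF).symm

end Facts

/-- **Registered sub-goal `convergence_subseq_of_planeLimits` (Z3a)**: along a `PlaneLimits` package the convergence clause of the
crux holds for the sub-scheme and the candidate family `planeSum T`. [folklore] -/
theorem convergence_subseq_of_planeLimits :
    ∀ (G : Type) [Group G] [TopologicalSpace G] [IsTopologicalGroup G] [CompactSpace G] [MeasurableSpace G] [BorelSpace G] (r : LatticeRep G) (sch : SpeciesScheme (YMSpecies G)) (φ : ℕ → ℕ) (hφ : StrictMono φ) (T : (n : ℕ) → (Fin n → Plane) → (𝓢((Fin n → EuclideanSpace ℝ (Fin 4)), ℂ) →L[ℂ] ℂ)), PlaneLimits r sch φ T → ∀ (n : ℕ), n ≠ 0 → ∀ (f : Fin n → 𝓢(EuclideanSpace ℝ (Fin 4), ℝ)) (F : 𝓢((Fin n → EuclideanSpace ℝ (Fin 4)), ℂ)), IsTensorOf F (fun i => ofRealTest (f i)) → IsOffDiagonal F → Tendsto (fun k : ℕ => ((latticeSchwinger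 r.ρ (subseq sch φ hφ) (fun s => s.F) k n (fun _ => r.curvature) f : ℝ) : ℂ)) atTop (𝓝 (planeSum T n F)) := by
  intro G _ _ _ _ _ _ r sch φ hφ T hPL n _ f F hF hod
  have hfun : (fun k : ℕ => ((latticeSchwinger r.ρ (subseq sch φ hφ) (fun s => s.F) k n (fun _ => r.curvature) f : ℝ) : ℂ)) =
      fun k => ∑ q : Fin n → Plane, planeDist r sch (φ k) n q F := by
    funext k
    rw [latticeSchwinger_subseq, latticeSchwinger_eq_sum_planeDist r sch (φ k) n f F hF]
  rw [hfun]
  exact hPL.tendsto_planeSum F hod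

end Summit.QuantumFields.YangMills.Cruxes.HypercubicLimit.CouplingResponse

end
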